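import Summits.KontsevichZagierPeriods.KontsevichZagierPeriods.Theorems.SoloInformedLinearClosure
import HarnessLib
import HarnessLib.Audit

/-!
# SoloInformed — the Chebyshev–Euler class `R(((ax+b)/(cx+d))^{1/m})`

Solo programme `solo-KontsevichZagierPeriods-informed`, session s112, file 36.

The classical elementary-integrable family `∫ R(x, ((ax+b)/(cx+d))^{1/m}) dx` (`a, b, c, d ∈ K`,
`ad ≠ bc`, `m ≥ 1`) is uniformised by ONE move of rule (2): `t = ((ax+b)/(cx+d))^{1/m}`, i.e.
`x = Φ(t) = (b − d t^m)/(c t^m − a)` on `S₀ = {t ≥ 0, c t^m ≠ a}`, with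
`|Φ'(t)| = |ad − bc|·m·t^{m−1}/(c t^m − a)²` — all `K`-rational in `t`.  Since `x = Φ(t)` is itself
`K`-rational in `t`, an integrand `K`-rational in `(x, t)` is `K`-rational in `t`; we type the class by
`f = P(y)/Q(y)`, `y = ((ax+b)/(cx+d))^{1/m}`, `P, Q ∈ K[X]` (`x = (b − d y^m)/(c y^m − a)` recovers `x`).
THEOREM `soloInformed_kzp_mobiusRadical`: such integrals (absolutely convergent, any `ℚ`-semialgebraic
`D ⊆ {cx + d ≠ 0, (ax+b)/(cx+d) ≥ 0}`) satisfy the Kontsevich–Zagier period conjecture against each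
other, the elementary(-sum) class, rational representations of dimension `≤ 1`, and the span of
points and segments.  Unconditional.  (`a = 1, b = 0, c = 0, d = 1` is file 24.)

References: M. Kontsevich, D. Zagier, *Periods* (2001), §1.2; P. L. Chebyshev (1853) on binomial
differentials; this work.
-/

noncomputable section

open scoped BigOperators Polynomial

namespace Summit.KontsevichZagierPeriods.KontsevichZagierPeriods.Theorems

open Set MeasureTheory
open Literature.ModelTheory.ExponentialFields
open Literature.NumberTheory.Transcendental Literature.NumberTheory.Transcendental.KZ

/-! ## The map `Φ(t) = (b − d t^m)/(c t^m − a)` -/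

/-- `Φ_{a,b,c,d,m}(t) = (b − d t^m)/(c t^m − a)`. -/
def soloInformedMobPowMap (a b c d : ℝ) (m : ℕ) : (Fin 1 → ℝ) → (Fin 1 → ℝ) :=
  fun w _ => (b - d * (w 0) ^ m) / (c * (w 0) ^ m - a)

/-- Its derivative at `w`: `((ad − bc)·m·t^{m−1}/(c t^m − a)²) • id`. -/
def soloInformedMobPowDeriv (a b c d : ℝ) (m : ℕ) (w : Fin 1 → ℝ) : (Fin 1 → ℝ) →L[ℝ] (Fin 1 → ℝ) :=
  ((a * d - b * c) * ((m : ℝ) * (w 0) ^ (m - 1)) / (c * (w 0) ^ m - a) ^ 2) •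
    ContinuousLinearMap.id ℝ (Fin 1 → ℝ)

/-- Pointwise formula. -/
@[simp] theorem soloInformed_mobPowMap_apply (a b c d : ℝ) (m : ℕ) (w : Fin 1 → ℝ) (i : Fin 1) :
    soloInformedMobPowMap a b c d m w i = (b - d * (w 0) ^ m) / (c * (w 0) ^ m - a) := rfl

/-- The scalar derivative. -/
theorem soloInformed_hasDerivAt_mobPow (a b c d : ℝ) (m : ℕ) {s : ℝ} (hs : c * s ^ m - a ≠ 0) :
    HasDerivAt (fun y : ℝ => (b - d * y ^ m) / (c * y ^ m - a))
      ((a * d - b * c) * ((m : ℝ) * s ^ (m - 1)) / (c * s ^ m - a) ^ 2) s := by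
  have hp := hasDerivAt_pow m s
  have hnum : HasDerivAt (fun y : ℝ => b - d * y ^ m) (-(d * ((m : ℝ) * s ^ (m - 1)))) s :=
    (hp.const_mul d).const_sub b
  have hden : HasDerivAt (fun y : ℝ => c * y ^ m - a) (c * ((m : ℝ) * s ^ (m - 1))) s :=
    (hp.const_mul c).sub_const a
  refine (hnum.div hden hs).congr_deriv ?_
  field_simp
  ring

/-- `Φ` is differentiable where `c t^m ≠ a`, with the stated derivative. -/
theorem soloInformed_hasFDerivAt_mobPowMap (a b c d : ℝ) (m : ℕ) {w : Fin 1 → ℝ}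
    (hw : c * (w 0) ^ m - a ≠ 0) :
    HasFDerivAt (soloInformedMobPowMap a b c d m) (soloInformedMobPowDeriv a b c d m w) w := by
  rw [hasFDerivAt_pi']
  intro i
  have h1 : HasFDerivAt (fun w : Fin 1 → ℝ => w 0)
      (ContinuousLinearMap.proj (R := ℝ) (φ := fun _ : Fin 1 => ℝ) 0) w :=
    (ContinuousLinearMap.proj (R := ℝ) (φ := fun _ : Fin 1 => ℝ) 0).hasFDerivAt
  have h2 := (soloInformed_hasDerivAt_mobPow a b c d m hw).comp_hasFDerivAt w h1
  refine h2.congr_fderiv ?_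
  ext v
  simp [soloInformedMobPowDeriv, Fin.fin_one_eq_zero i]

/-- The Jacobian determinant of `Φ`. -/
theorem soloInformed_det_mobPowDeriv (a b c d : ℝ) (m : ℕ) (w : Fin 1 → ℝ) :
    (soloInformedMobPowDeriv a b c d m w).det =
      (a * d - b * c) * ((m : ℝ) * (w 0) ^ (m - 1)) / (c * (w 0) ^ m - a) ^ 2 := by
  unfold soloInformedMobPowDeriv
  rw [ContinuousLinearMap.det, ContinuousLinearMap.toLinearMap_smul, ContinuousLinearMap.coe_id,
    LinearMap.det_smul, LinearMap.det_id, Module.finrank_fin_fun]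
  simp

/-- `|det Φ'(t)| = |ad − bc|·m·t^{m−1}/(c t^m − a)²` for `t ≥ 0`. -/
theorem soloInformed_abs_det_mobPowDeriv (a b c d : ℝ) (m : ℕ) {w : Fin 1 → ℝ} (hw : 0 ≤ w 0) :
    |(soloInformedMobPowDeriv a b c d m w).det| =
      |a * d - b * c| * ((m : ℝ) * (w 0) ^ (m - 1)) / (c * (w 0) ^ m - a) ^ 2 := by
  rw [soloInformed_det_mobPowDeriv, abs_div, abs_mul,
    abs_of_nonneg (mul_nonneg (Nat.cast_nonneg m) (pow_nonneg hw (m - 1))),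
    abs_of_nonneg (sq_nonneg (c * (w 0) ^ m - a))]

/-- `Φ` is injective on `{t ≥ 0, c t^m ≠ a}` when `ad ≠ bc` and `m ≠ 0`. -/
theorem soloInformed_injOn_mobPowMap {a b c d : ℝ} {m : ℕ} (hm : m ≠ 0) (h : a * d - b * c ≠ 0) :
    InjOn (soloInformedMobPowMap a b c d m) {t : Fin 1 → ℝ | 0 ≤ t 0 ∧ c * (t 0) ^ m - a ≠ 0} := by
  intro u hu v hv huv
  have h0 : (b - d * (u 0) ^ m) / (c * (u 0) ^ m - a) = (b - d * (v 0) ^ m) / (c * (v 0) ^ m - a) :=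
    congr_fun huv 0
  rw [div_eq_div_iff hu.2 hv.2] at h0
  have h1 : (a * d - b * c) * ((u 0) ^ m - (v 0) ^ m) = 0 := by linear_combination h0
  have h2 : (u 0) ^ m = (v 0) ^ m := by
    have := (mul_eq_zero.1 h1).resolve_left h
    linarith
  have h3 : u 0 = v 0 := (pow_left_inj₀ hu.1 hv.1 hm).1 h2
  rw [KZ.eq_const_apply_zero u, KZ.eq_const_apply_zero v, h3]

/-- The Möbius inversion identities: with `s = t^m`, `x = (b − d s)/(c s − a)` gives
`c x + d ≠ 0` and `(a x + b)/(c x + d) = s`. -/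
theorem soloInformed_mobius_inv {a b c d s : ℝ} (h : a * d - b * c ≠ 0) (hs : c * s - a ≠ 0) :
    c * ((b - d * s) / (c * s - a)) + d ≠ 0 ∧
      (a * ((b - d * s) / (c * s - a)) + b) / (c * ((b - d * s) / (c * s - a)) + d) = s := by
  have hcd : c * ((b - d * s) / (c * s - a)) + d = (b * c - a * d) / (c * s - a) := by
    rw [mul_div_assoc', div_add' _ _ _ hs]
    congr 1
    ring
  have hne : c * ((b - d * s) / (c * s - a)) + d ≠ 0 := by
    rw [hcd]; exact div_ne_zero (fun h' => h (by linarith)) hs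
  refine ⟨hne, ?_⟩
  rw [div_eq_iff hne, hcd, mul_div_assoc', div_add' _ _ _ hs, mul_div_assoc', div_eq_div_iff hs hs]
  ring

/-- Conversely, with `q = (a x + b)/(c x + d)` (`c x + d ≠ 0`): `c q − a ≠ 0` and
`(b − d q)/(c q − a) = x`. -/
theorem soloInformed_mobius_inv' {a b c d x : ℝ} (h : a * d - b * c ≠ 0) (hx : c * x + d ≠ 0) :
    c * ((a * x + b) / (c * x + d)) - a ≠ 0 ∧
      (b - d * ((a * x + b) / (c * x + d))) / (c * ((a * x + b) / (c * x + d)) - a) = x := by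
  have hca : c * ((a * x + b) / (c * x + d)) - a = (b * c - a * d) / (c * x + d) := by
    rw [mul_div_assoc', div_sub' hx]
    congr 1
    ring
  have hne : c * ((a * x + b) / (c * x + d)) - a ≠ 0 := by
    rw [hca]; exact div_ne_zero (fun h' => h (by linarith)) hx
  refine ⟨hne, ?_⟩
  rw [div_eq_iff hne, hca, mul_div_assoc', sub_div' hx, mul_div_assoc', div_eq_div_iff hx hx]
  ring

/-! ## Semialgebraicity over `ℚ` (parameters in `K`) -/

/-- `Φ` with parameters in `K` is `ℚ`-semialgebraic on `ℚ`-semialgebraic subsets of `{c t^m ≠ a}`. -/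
theorem soloInformed_isSemialgebraicMapOn_mobPowMap (a b c d : algebraicClosure ℚ ℝ) (m : ℕ)
    {s : Set (Fin 1 → ℝ)} (hs : IsSemialgebraic ℚ s)
    (hs0 : ∀ w ∈ s, algebraMap _ ℝ c * (w 0) ^ m - algebraMap _ ℝ a ≠ 0) :
    IsSemialgebraicMapOn ℚ s (soloInformedMobPowMap (algebraMap _ ℝ a) (algebraMap _ ℝ b)
      (algebraMap _ ℝ c) (algebraMap _ ℝ d) m) := by
  have hK := soloInformed_isAlgebraic_algebraMap_K
  refine IsSemialgebraicMapOn.of_forall hs fun i => ?_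
  refine ((soloInformed_isSemialgebraicFunOn_aevalK hK hs
      (MvPolynomial.C b - MvPolynomial.C d * MvPolynomial.X 0 ^ m :
        MvPolynomial (Fin 1) (algebraicClosure ℚ ℝ))).div
    (soloInformed_isSemialgebraicFunOn_aevalK hK hs
      (MvPolynomial.C c * MvPolynomial.X 0 ^ m - MvPolynomial.C a :
        MvPolynomial (Fin 1) (algebraicClosure ℚ ℝ))) fun w hw => ?_).congr fun w _ => ?_
  · simpa using hs0 w hw
  · simp

/-- `|det Φ'|` with parameters in `K` is `ℚ`-semialgebraic on `ℚ`-semialgebraic subsets of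
`{t ≥ 0, c t^m ≠ a}`. -/
theorem soloInformed_isSemialgebraicFunOn_abs_det_mobPowDeriv (a b c d : algebraicClosure ℚ ℝ) (m : ℕ)
    {s : Set (Fin 1 → ℝ)} (hs : IsSemialgebraic ℚ s)
    (hs0 : ∀ w ∈ s, 0 ≤ w 0 ∧ algebraMap _ ℝ c * (w 0) ^ m - algebraMap _ ℝ a ≠ 0) :
    IsSemialgebraicFunOn ℚ s fun t => |(soloInformedMobPowDeriv (algebraMap _ ℝ a) (algebraMap _ ℝ b)
      (algebraMap _ ℝ c) (algebraMap _ ℝ d) m t).det| := by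
  have hK := soloInformed_isAlgebraic_algebraMap_K
  refine ((soloInformed_isSemialgebraicFunOn_aevalK hK hs
      (MvPolynomial.C (|a * d - b * c| * m) * MvPolynomial.X 0 ^ (m - 1) :
        MvPolynomial (Fin 1) (algebraicClosure ℚ ℝ))).div
    (soloInformed_isSemialgebraicFunOn_aevalK hK hs
      ((MvPolynomial.C c * MvPolynomial.X 0 ^ m - MvPolynomial.C a) ^ 2 :
        MvPolynomial (Fin 1) (algebraicClosure ℚ ℝ))) fun w hw => ?_).congr fun w hw => ?_
  · simpa using (hs0 w hw).2
  · rw [soloInformed_abs_det_mobPowDeriv _ _ _ _ _ (hs0 w hw).1]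
    simp only [map_mul, map_pow, map_sub, MvPolynomial.aeval_C, MvPolynomial.aeval_X, map_natCast,
      soloInformed_algebraMap_abs_K, map_mul, map_sub]
    ring

/-! ## The class and the theorem -/

/-- `r = [D, f]` with `f = P(y)/Q(y)`, `y = ((a x + b)/(c x + d))^{1/m}`, `P, Q ∈ K[X]`, `a, b, c, d ∈ K`,
`ad ≠ bc`, on `D ⊆ {c x + d ≠ 0, (ax+b)/(cx+d) ≥ 0, Q(y) ≠ 0}`. -/
def SoloInformedIsKMobiusRadicalOne (m : ℕ) (r : IntegralRep 1) : Prop :=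
  ∃ (a b c d : algebraicClosure ℚ ℝ) (P Q : (algebraicClosure ℚ ℝ)[X]),
    algebraMap _ ℝ a * algebraMap _ ℝ d - algebraMap _ ℝ b * algebraMap _ ℝ c ≠ 0 ∧
    (∀ x ∈ r.domain, algebraMap _ ℝ c * x 0 + algebraMap _ ℝ d ≠ 0 ∧
      0 ≤ (algebraMap _ ℝ a * x 0 + algebraMap _ ℝ b) / (algebraMap _ ℝ c * x 0 + algebraMap _ ℝ d) ∧
      (Polynomial.aeval (((algebraMap _ ℝ a * x 0 + algebraMap _ ℝ b) /
        (algebraMap _ ℝ c * x 0 + algebraMap _ ℝ d)) ^ ((m : ℝ)⁻¹)) Q : ℝ) ≠ 0) ∧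
    EqOn r.integrand (fun x =>
      (Polynomial.aeval (((algebraMap _ ℝ a * x 0 + algebraMap _ ℝ b) /
        (algebraMap _ ℝ c * x 0 + algebraMap _ ℝ d)) ^ ((m : ℝ)⁻¹)) P : ℝ) /
      Polynomial.aeval (((algebraMap _ ℝ a * x 0 + algebraMap _ ℝ b) /
        (algebraMap _ ℝ c * x 0 + algebraMap _ ℝ d)) ^ ((m : ℝ)⁻¹)) Q) r.domain

/-- **The Chebyshev–Euler class lies in the span of points and segments.** -/
theorem soloInformed_segSpan_of_isKMobiusRadicalOne {m : ℕ} (hm : m ≠ 0) (r : IntegralRep 1)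
    (hr : SoloInformedIsKMobiusRadicalOne m r) : of r ∈ soloInformedSegSpan := by
  obtain ⟨a, b, c, d, P, Q, hadbc, hD, hf⟩ := hr
  set a' := algebraMap (algebraicClosure ℚ ℝ) ℝ a with ha'
  set b' := algebraMap (algebraicClosure ℚ ℝ) ℝ b with hb'
  set c' := algebraMap (algebraicClosure ℚ ℝ) ℝ c with hc'
  set d' := algebraMap (algebraicClosure ℚ ℝ) ℝ d with hd'
  set S₀ : Set (Fin 1 → ℝ) := {t | 0 ≤ t 0 ∧ c' * (t 0) ^ m - a' ≠ 0} with hS₀def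
  have hK := soloInformed_isAlgebraic_algebraMap_K
  have hS₀ : IsSemialgebraic ℚ S₀ := by
    have hX := (isSemialgebraicFunOn_aeval isSemialgebraic_univ
      (MvPolynomial.X 0 : MvPolynomial (Fin 1) ℚ)).isSemialgebraic_sep_nonneg
    have hV := (soloInformed_isSemialgebraicFunOn_aevalK hK isSemialgebraic_univ
      (MvPolynomial.C c * MvPolynomial.X 0 ^ m - MvPolynomial.C a :
        MvPolynomial (Fin 1) (algebraicClosure ℚ ℝ))).isSemialgebraic_sep_neg
    have hV' := (soloInformed_isSemialgebraicFunOn_aevalK hK isSemialgebraic_univ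
      (-(MvPolynomial.C c * MvPolynomial.X 0 ^ m - MvPolynomial.C a) :
        MvPolynomial (Fin 1) (algebraicClosure ℚ ℝ))).isSemialgebraic_sep_neg
    convert hX.inter (hV.union hV') using 1
    ext t
    simp only [hS₀def, mem_setOf_eq, mem_inter_iff, mem_union, mem_univ, true_and,
      MvPolynomial.aeval_X, map_neg, map_sub, map_mul, map_pow, MvPolynomial.aeval_C, neg_lt_zero]
    rw [← hc', ← ha', lt_or_lt_iff_ne]
  set Φ := soloInformedMobPowMap a' b' c' d' m with hΦdef
  set Φ' := soloInformedMobPowDeriv a' b' c' d' m with hΦ'def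
  have hΦ : IsSemialgebraicMapOn ℚ S₀ Φ :=
    soloInformed_isSemialgebraicMapOn_mobPowMap a b c d m hS₀ fun w hw => hw.2
  have hderiv : ∀ t ∈ S₀, HasFDerivAt Φ (Φ' t) t := fun t ht =>
    soloInformed_hasFDerivAt_mobPowMap _ _ _ _ _ ht.2
  have hinj : InjOn Φ S₀ := soloInformed_injOn_mobPowMap hm hadbc
  have hjac : IsSemialgebraicFunOn ℚ S₀ fun t => |(Φ' t).det| :=
    soloInformed_isSemialgebraicFunOn_abs_det_mobPowDeriv a b c d m hS₀ fun w hw => hw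
  have hsurj : r.domain ⊆ Φ '' S₀ := fun x hx => by
    obtain ⟨hcx, hq, -⟩ := hD x hx
    have hmi := soloInformed_mobius_inv' hadbc hcx
    refine ⟨fun _ => ((a' * x 0 + b') / (c' * x 0 + d')) ^ ((m : ℝ)⁻¹), ⟨Real.rpow_nonneg hq _, ?_⟩, ?_⟩
    · show c' * (((a' * x 0 + b') / (c' * x 0 + d')) ^ ((m : ℝ)⁻¹)) ^ m - a' ≠ 0
      rw [Real.rpow_inv_natCast_pow hq hm]
      exact hmi.1
    · funext i
      rw [Fin.fin_one_eq_zero i, hΦdef, soloInformed_mobPowMap_apply]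
      show (b' - d' * (((a' * x 0 + b') / (c' * x 0 + d')) ^ ((m : ℝ)⁻¹)) ^ m) /
          (c' * (((a' * x 0 + b') / (c' * x 0 + d')) ^ ((m : ℝ)⁻¹)) ^ m - a') = x 0
      rw [Real.rpow_inv_natCast_pow hq hm]
      exact hmi.2
  obtain ⟨R', hdom, hint, hrel⟩ := soloInformed_exists_subst Φ Φ' hΦ hderiv hinj hjac r hsurj
  -- on the new domain: `t ≥ 0`, `c t^m ≠ a`, `Φ t ∈ D`, and `y(Φ t) = t`
  have hmemD : ∀ t ∈ R'.domain, (0 ≤ t 0 ∧ c' * (t 0) ^ m - a' ≠ 0) ∧ Φ t ∈ r.domain := fun t ht => by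
    rw [hdom] at ht; exact ht
  have hy : ∀ t ∈ R'.domain, c' * Φ t 0 + d' ≠ 0 ∧
      ((a' * Φ t 0 + b') / (c' * Φ t 0 + d')) ^ ((m : ℝ)⁻¹) = t 0 := fun t ht => by
    obtain ⟨⟨ht0, hV⟩, -⟩ := hmemD t ht
    have hmi := soloInformed_mobius_inv (s := (t 0) ^ m) hadbc hV
    rw [hΦdef, soloInformed_mobPowMap_apply]
    exact ⟨hmi.1, by rw [hmi.2, Real.pow_rpow_inv_natCast ht0 hm]⟩
  refine soloInformed_segSpan_of_subst hrel (soloInformed_segSpan_of_isKRationalOne R'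
    ⟨P * (Polynomial.C (|a * d - b * c| * m) * Polynomial.X ^ (m - 1)),
      Q * (Polynomial.C c * Polynomial.X ^ m - Polynomial.C a) ^ 2, fun t ht => ?_, fun t ht => ?_⟩)
  · obtain ⟨⟨ht0, hV⟩, hΦt⟩ := hmemD t ht
    have hQ := (hD _ hΦt).2.2
    rw [(hy t ht).2] at hQ
    rw [map_mul, map_pow]
    refine mul_ne_zero hQ (pow_ne_zero _ ?_)
    simpa [← hc', ← ha'] using hV
  · obtain ⟨⟨ht0, hV⟩, hΦt⟩ := hmemD t ht
    rw [hint]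
    show r.integrand (Φ t) * |(Φ' t).det| = _
    rw [hf hΦt, hΦ'def, soloInformed_abs_det_mobPowDeriv _ _ _ _ _ ht0]
    show (Polynomial.aeval (((a' * Φ t 0 + b') / (c' * Φ t 0 + d')) ^ ((m : ℝ)⁻¹)) P : ℝ) /
        Polynomial.aeval (((a' * Φ t 0 + b') / (c' * Φ t 0 + d')) ^ ((m : ℝ)⁻¹)) Q *
        (|a' * d' - b' * c'| * ((m : ℝ) * t 0 ^ (m - 1)) / (c' * t 0 ^ m - a') ^ 2) = _
    rw [(hy t ht).2, div_mul_div_comm]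
    simp only [map_mul, map_pow, map_sub, Polynomial.aeval_C, Polynomial.aeval_X, map_natCast,
      soloInformed_algebraMap_abs_K, ← ha', ← hb', ← hc', ← hd']
    ring

/-- **The Kontsevich–Zagier period conjecture for the Chebyshev–Euler class**
`∫_D R(((ax+b)/(cx+d))^{1/m}) dx` over `K`: against each other (any `m, m' ≥ 1`), the elementary-sum
class, rational representations of dimension `≤ 1`, and every member of the span of points and
segments.  Unconditional. [Kontsevich–Zagier 2001, §1.2 Question 1; this work] -/
theorem soloInformed_kzp_mobiusRadical {m m' : ℕ} (hm : m ≠ 0) (hm' : m' ≠ 0) (r r' : IntegralRep 1)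
    (hr : SoloInformedIsKMobiusRadicalOne m r) (hr' : SoloInformedIsKMobiusRadicalOne m' r') :
    (r.value = r'.value → Equivalent r r') ∧
    (∀ r₁ : IntegralRep 1, SoloInformedIsKElementarySumOne r₁ → r.value = r₁.value → Equivalent r r₁) ∧
    (∀ {n : ℕ} (hn : n ≤ 1) (r₀ : IntegralRep n), r₀.IsRational → r.value = r₀.value →
      Equivalent r r₀) ∧
    (∀ {k : ℕ} (r₂ : IntegralRep k), of r₂ ∈ soloInformedSegSpan → r.value = r₂.value →
      Equivalent r r₂) := by
  have h := soloInformed_segSpan_of_isKMobiusRadicalOne hm r hr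
  exact ⟨fun hv => soloInformed_equivalent_of_mem_segSpan h
      (soloInformed_segSpan_of_isKMobiusRadicalOne hm' r' hr') hv,
    fun r₁ hr₁ hv => soloInformed_equivalent_of_mem_segSpan h
      (soloInformed_segSpan_of_isKElementarySumOne r₁ hr₁) hv,
    fun hn r₀ hr₀ hv => soloInformed_equivalent_of_mem_segSpan h
      (soloInformed_of_mem_segSpan_of_isRational hn r₀ hr₀) hv,
    fun r₂ hr₂ hv => soloInformed_equivalent_of_mem_segSpan h hr₂ hv⟩

/-- Kernel form: a member of the Chebyshev–Euler class of value `0` is a relation. -/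
theorem soloInformed_mem_relations_of_value_eq_zero_mobiusRadical {m : ℕ} (hm : m ≠ 0)
    (r : IntegralRep 1) (hr : SoloInformedIsKMobiusRadicalOne m r) (h0 : r.value = 0) :
    of r ∈ relations :=
  soloInformed_mem_relations_of_mem_segSpan (soloInformed_segSpan_of_isKMobiusRadicalOne hm r hr)
    (by rw [eval_of]; exact h0)

end Summit.KontsevichZagierPeriods.KontsevichZagierPeriods.Theorems
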